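import Literature.NumberTheory.EllipticCurves.ArchimedeanH1CardLeTwo
import Literature.NumberTheory.EllipticCurves.ShaRestriction
import HarnessLib

/-!
# Route `GenusKolyvaginAtTwo`, crux L⁺_T `PowDvdShaCardAtTwoPosT` (stmt-BirchSwinnertonDyer-23379), LINE 19 —
# THE TORSOR-LEVEL ARCHIMEDEAN BIT (the `harch` hypothesis of gk2-p3's `Δ > 0` frame theorem), PROVED

Pen `bsd-idea-1` g12 (planner; typed 2026-08-29 for a PROVER to land `--supports stmt-BirchSwinnertonDyer-23379 --as helper`;
the pen cannot propose under `Theorems/`); landed VERBATIM by seat `bsd-line-gk2-p3` g27, which consumes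
`archimedeanBit_sha_comap_resBaseChange` as the archimedean input of the sign-free relaxed index on `Δ > 0` (the on-cut upper
half of Q4_T, stmt-BirchSwinnertonDyer-23378). THEOREMS ONLY, no `sorry`. BSD is not proved by any of this; neither is the crux.

gk2-p3 g18 (`…PosTLadderFrame`): «its torsor-level form is NOT yet in the tree and is the one residual input of this file» — the
hypotheses `harch`, `harch'` of `GenusExact.RegularPlusDescent.two_mul_le_padicValNat_add_of_shaLadders_of_arch`.  It IS in reach:
gk2-p2 g15's Literature file `ArchimedeanH1CardLeTwo` proves `#H¹(K_w, E) ≤ 2` and `[H¹(K, E) : ker(H¹(K, E) → H¹(K_w, E))] ≤ 2`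
(`WeierstrassCurve.index_localRestrictionKer_infinitePlace_le_two`, `finite_localH1_infinitePlace`) at TORSOR level; with
`Unique (InfinitePlace ℚ)` the torsor-level bit follows verbatim as gk2-p2's finite-level
`relIndex_inf_iInf_selmerLocalKer_infinitePlace_le_two / _ne_zero` (`…PosTArchimedeanBit` §1).

* `relIndex_inf_iInf_localRestrictionKer_infinitePlace_le_two` — for EVERY subgroup `X ≤ H¹(ℚ, E)`: `[X : X ⊓ ⨅_∞ ker] ≤ 2`;
* `relIndex_inf_iInf_localRestrictionKer_infinitePlace_ne_zero` — `… ≠ 0`;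
* `relIndex_inf_iInf_localRestrictionKer_infinitePlace_dvd_two` — `… ∣ 2`;
* `archimedeanBit_sha_comap_resBaseChange` — the instance `X = res⁻¹(Ш(E_K/K))`, VERBATIM `harch` of the frame theorem, for every
  `E/ℚ` and every number field `K` (sign-free).
References: [MilneADT2006] I Rem. 3.7; [SilvermanAEC2009] X.§4; [Kramer1981] §2.
-/

noncomputable section

-- `Summit.<P>.<Sub>` repeats `BirchSwinnertonDyer` by the tree's layout convention (D-0017)
set_option linter.dupNamespace false

namespace Summit.BirchSwinnertonDyer.BirchSwinnertonDyer.Theorems.GenusExact.RegularPlusDescent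

open _root_.WeierstrassCurve AddSubgroup NumberField Literature.NumberTheory.EllipticCurves

variable (W : WeierstrassCurve ℚ) [W.IsElliptic]

/-- The local kernel at the infinite place of `ℚ` has finite (non-zero) index in `H¹(ℚ, E)`: the quotient embeds in the finite
`H¹(ℝ, E)`. [cite: MilneADT2006, I Rem. 3.7] -/
theorem index_localRestrictionKer_infinitePlace_ne_zero (w : InfinitePlace ℚ) :
    (W.localRestrictionKer w.Completion).index ≠ 0 := by
  haveI : Finite (W.localH1 w.Completion) := by
    rw [← galoisCohomology_localGaloisModule_one]
    exact W.finite_localH1_infinitePlace w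
  rw [localRestrictionKer_eq_ker, AddSubgroup.index_ker]
  exact Nat.card_pos.ne'

/-- **THE TORSOR-LEVEL ARCHIMEDEAN BIT.** For `E/ℚ` and EVERY subgroup `X ≤ H¹(ℚ, E)`: `[X : X ⊓ ⨅_∞ ker(H¹(ℚ,E) → H¹(ℚ_w,E))] ≤ 2`
(`ℚ` has one infinite place; `#H¹(ℝ, E) ≤ 2`). [cite: MilneADT2006, I Rem. 3.7] -/
theorem relIndex_inf_iInf_localRestrictionKer_infinitePlace_le_two (X : AddSubgroup W.galH1) :
    (X ⊓ ⨅ w : InfinitePlace ℚ, W.localRestrictionKer w.Completion).relIndex X ≤ 2 := by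
  rw [AddSubgroup.inf_relIndex_left, iInf_unique]
  have h2 := W.index_localRestrictionKer_infinitePlace_le_two (default : InfinitePlace ℚ)
  have h0 := index_localRestrictionKer_infinitePlace_ne_zero W (default : InfinitePlace ℚ)
  refine le_trans ?_ h2
  rw [← AddSubgroup.relIndex_top_right]
  exact AddSubgroup.relIndex_le_of_le_right le_top (by rwa [AddSubgroup.relIndex_top_right])

/-- The torsor-level archimedean bit as a non-vanishing: `[X : X ⊓ ⨅_∞ ker] ≠ 0`. [cite: MilneADT2006, I Rem. 3.7] -/
theorem relIndex_inf_iInf_localRestrictionKer_infinitePlace_ne_zero (X : AddSubgroup W.galH1) :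
    (X ⊓ ⨅ w : InfinitePlace ℚ, W.localRestrictionKer w.Completion).relIndex X ≠ 0 := by
  rw [AddSubgroup.inf_relIndex_left, iInf_unique]
  have h0 := index_localRestrictionKer_infinitePlace_ne_zero W (default : InfinitePlace ℚ)
  exact fun h ↦ h0 (Nat.eq_zero_of_zero_dvd (h ▸ AddSubgroup.relIndex_dvd_index_of_normal _ _))

/-- The torsor-level archimedean bit in the `∣ 2` form. [cite: MilneADT2006, I Rem. 3.7] -/
theorem relIndex_inf_iInf_localRestrictionKer_infinitePlace_dvd_two (X : AddSubgroup W.galH1) :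
    (X ⊓ ⨅ w : InfinitePlace ℚ, W.localRestrictionKer w.Completion).relIndex X ∣ 2 := by
  have hle := relIndex_inf_iInf_localRestrictionKer_infinitePlace_le_two W X
  have hne := relIndex_inf_iInf_localRestrictionKer_infinitePlace_ne_zero W X
  obtain ⟨n, hn⟩ : ∃ n, (X ⊓ ⨅ w : InfinitePlace ℚ, W.localRestrictionKer w.Completion).relIndex X = n := ⟨_, rfl⟩
  rw [hn] at hle hne ⊢
  interval_cases n
  · exact absurd rfl hne
  · exact one_dvd _
  · exact dvd_rfl

/-- **`harch` of the `Δ > 0` frame theorem, discharged**: for every `E/ℚ` and every number field `K`,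
`[res⁻¹Ш(E_K/K) : res⁻¹Ш(E_K/K) ⊓ ⨅_∞ ker] ∣ 2` — VERBATIM the hypothesis `harch` (and, with `E := Wd`, `harch'`) of
`two_mul_le_padicValNat_add_of_shaLadders_of_arch` / `twinLadderGenusPos_ineq_of_shaLadders_of_padicValNat_eq_zero`.
[cite: MilneADT2006, I Rem. 3.7] [cite: Kramer1981, §2] -/
theorem archimedeanBit_sha_comap_resBaseChange (K : Type) [Field K] [NumberField K] :
    ((((W.baseChange K).sha).comap (resBaseChange W K)) ⊓
        ⨅ w : InfinitePlace ℚ, W.localRestrictionKer w.Completion).relIndex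
      (((W.baseChange K).sha).comap (resBaseChange W K)) ∣ 2 :=
  relIndex_inf_iInf_localRestrictionKer_infinitePlace_dvd_two W _

end Summit.BirchSwinnertonDyer.BirchSwinnertonDyer.Theorems.GenusExact.RegularPlusDescent

end
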